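import Mathlib.Probability.Distributions.Uniform
import Mathlib.Probability.ProbabilityMassFunction.Monad
import Mathlib.Data.Fintype.Perm
import Mathlib.Data.Fintype.Vector
import Mathlib.Analysis.Asymptotics.SuperpolynomialDecay
import Literature.Computability.Cryptography.PseudorandomFunctions
import Literature.Computability.Cryptography.OracleGames
import HarnessLib

/-!
# Pseudorandom permutations (PRPs)

A *pseudorandom permutation ensemble* is a keyed function family
`F n : {0,1}^{κ(n)} × {0,1}^{ℓ(n)} → {0,1}^{ℓ(n)}` that is efficiently computable, is a
PERMUTATION of `{0,1}^{ℓ(n)}` for every well-formed key, and cannot be told apart — by any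
probabilistic polynomial-time oracle machine given `1ⁿ` — from a uniformly random permutation
of `{0,1}^{ℓ(n)}` with more than negligible advantage (Luby–Rackoff 1988; Goldreich 2001,
§3.7, Def. 3.7.2; Aaronson–Chen 2017, Def. 7.1–7.2: "a pseudorandom permutation `PRP` is
(classically) secure if no classical adversary `A` can distinguish between a truly random
permutation and the function `PRP_k` for a random `k` in polynomial time").

This file is the permutation analogue of `PseudorandomFunctions.lean` (C4), on the same game
infrastructure (C4a `OracleAdversary`, `oracleOfTable`, `prfRealPMF`):

* `randomPermPMF a` — the uniformly random permutation of `{0,1}^a` (ideal object);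
* `prpIdealPMF` / `prpIdealProb` — the ideal game (oracle = a uniformly random permutation);
  the real game is the PRF real game `prfRealPMF F κ ℓ` (oracle `F n k`, `k ← U_{κ n}`);
  `prpAdvantage := |real − ideal|`;
* `IsPermutationFamily F κ ℓ` — every well-keyed `F n k` is a bijection of `{0,1}^{ℓ n}`;
* `IsPRP F κ ℓ`, `PRPExist` (block length at least the security parameter, see below);
* the named fact `PRPExist_of_PRFExist` (Luby–Rackoff: pseudorandom functions yield
  pseudorandom permutations).

## Design notes

* Security is against CLASSICAL uniform PPT adversaries with oracle access to the forward
  direction only (Goldreich's "pseudorandom", not "strongly pseudorandom", permutations; no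
  inversion oracle, no efficient-inversion requirement) — exactly the notion Aaronson–Chen use
  (Def. 7.2). Quantum security (Def. 7.3, Zhandry 2012) is not defined here.
* `PRPExist` quantifies over the key and block lengths `κ, ℓ` (polynomially bounded through
  `IsEfficientFamily`) but demands `n ≤ ℓ n`: without a floor on the block length the notion is
  vacuous (`ℓ = 0`: the only permutation of `{[]}` is a "PRP"), and consumers (Zhandry's
  construction, Aaronson–Chen §7.2: "domain `[N]`, `N = N(n)`") need exponentially large
  domains. Luby–Rackoff's construction gives `ℓ n = 2n` from length-preserving PRFs.
* Ill-formed oracle queries are answered by `[]` in both games (`oracleOfFnAt`, `oracleOfTable`).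

## References

* M. Luby, C. Rackoff, *How to construct pseudorandom permutations from pseudorandom
  functions*, SIAM J. Comput. 17 (1988) 373–386 [LubyRackoff1988] (held: CRYPTO '85 abstract,
  LNCS 218 p. 447: "if `f^n` is pseudo-random then `p^{2n}` is also pseudo-random").
* O. Goldreich, *Foundations of Cryptography I*, CUP 2001, §3.7, Def. 3.7.2 (pseudorandom
  permutation ensembles; held 2004 printing, p. 201) [Goldreich2001].
* S. Aaronson, L. Chen, *Complexity-theoretic foundations of quantum supremacy experiments*,
  CCC 2017 (arXiv:1612.05903), §7.1, Def. 7.1–7.2 and Lemma 7.4 (p. 29) [AaronsonChen2017].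

## Mathlib

`PMF.uniformOfFintype`, `Equiv.Perm` with its `Fintype` instance (`Mathlib.Data.Fintype.Perm`),
`Set.BijOn`, `Asymptotics.SuperpolynomialDecay`. Mathlib has no pseudorandom permutations
(searched `PRP`, `[Pp]seudorandom`, `Feistel`, `LubyRackoff`: nothing).
-/

namespace Literature.Computability.Cryptography

open Filter Asymptotics _root_.Computability Complexity

/-! ### The ideal object and the PRP game -/

/-- The uniformly random permutation of `{0,1}^a` (a uniform element of the finite type of
permutations of `List.Vector Bool a`; the ideal object of the PRP game).
[cite: Goldreich2001, §3.7 (the uniform permutation ensemble) and Def. 3.7.2] -/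
noncomputable def randomPermPMF (a : ℕ) : PMF (Equiv.Perm (List.Vector Bool a)) :=
  PMF.uniformOfFintype _

/-- The output law of the *ideal* PRP game at security parameter `n`: draw a uniformly random
permutation `σ` of `{0,1}^{ℓ n}` and run the oracle adversary `𝒜` on `1ⁿ` with oracle
`oracleOfTable σ` (queries of length `ℓ n` answered by `σ`, others by `[]`).
[cite: Goldreich2001, Def. 3.7.2] [cite: AaronsonChen2017, Def. 7.2] -/
noncomputable def prpIdealPMF (ℓ : ℕ → ℕ) (𝒜 : OracleAdversary Bool) (n : ℕ) : PMF (Option Bool) :=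
  (randomPermPMF (ℓ n)).bind fun σ => 𝒜.outputPMF (oracleOfTable σ) (unaryEncodeNat n)

/-- `prpIdealProb ℓ 𝒜 n = Pr_σ[𝒜^σ(1ⁿ) = 1]` for a uniformly random permutation `σ` of
`{0,1}^{ℓ n}`. [cite: Goldreich2001, Def. 3.7.2] [cite: AaronsonChen2017, Def. 7.2] -/
noncomputable def prpIdealProb (ℓ : ℕ → ℕ) (𝒜 : OracleAdversary Bool) (n : ℕ) : ℝ :=
  (prpIdealPMF ℓ 𝒜 n (some true)).toReal

/-- The PRP distinguishing advantage of `𝒜` against `F` at security parameter `n`: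
`|Pr_{k ← U_{κ n}}[𝒜^{F n k}(1ⁿ) = 1] − Pr_σ[𝒜^σ(1ⁿ) = 1]|` (real game = the PRF real game
`prfRealProb F κ ℓ`). [cite: Goldreich2001, Def. 3.7.2] [cite: AaronsonChen2017, Def. 7.2] -/
noncomputable def prpAdvantage (F : FunctionEnsemble) (κ ℓ : ℕ → ℕ) (𝒜 : OracleAdversary Bool)
    (n : ℕ) : ℝ :=
  |prfRealProb F κ ℓ 𝒜 n - prpIdealProb ℓ 𝒜 n|

/-! ### Permutation ensembles and pseudorandom permutations -/

/-- `IsPermutationFamily F κ ℓ`: for every `n` and every well-formed key `k ∈ {0,1}^{κ n}`, the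
keyed function `F n k` is a bijection of `{0,1}^{ℓ n}` onto itself ("`PRP_k` is a permutation on
`X` for each `k ∈ K`"). [cite: AaronsonChen2017, Def. 7.1] [cite: Goldreich2001, §3.7 (permutation ensembles)] -/
def IsPermutationFamily (F : FunctionEnsemble) (κ ℓ : ℕ → ℕ) : Prop :=
  ∀ n k, k.length = κ n →
    Set.BijOn (F n k) {x : List Bool | x.length = ℓ n} {x : List Bool | x.length = ℓ n}

/-- `IsPRP F κ ℓ`: `F` is a (classically secure) *pseudorandom permutation ensemble* with key
length `κ` and block length `ℓ` — efficiently computable (`IsEfficientFamily F κ ℓ ℓ`), a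
permutation of `{0,1}^{ℓ n}` under every well-formed key, and every probabilistic
polynomial-time oracle adversary has negligible (superpolynomially decaying) advantage in
distinguishing oracle access to `F n k` (`k ← U_{κ n}`) from oracle access to a uniformly random
permutation of `{0,1}^{ℓ n}`. Forward oracle only (not the "strong" notion).
[cite: Goldreich2001, Def. 3.7.2] [cite: AaronsonChen2017, Def. 7.1–7.2] [cite: LubyRackoff1988, abstract] -/
def IsPRP (F : FunctionEnsemble) (κ ℓ : ℕ → ℕ) : Prop :=
  IsEfficientFamily F κ ℓ ℓ ∧ IsPermutationFamily F κ ℓ ∧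
    ∀ 𝒜 : OracleAdversary Bool, 𝒜.IsPPT encodingBoolBool →
      SuperpolynomialDecay atTop (fun n : ℕ => (n : ℝ)) (prpAdvantage F κ ℓ 𝒜)

/-- `PRPExist`: pseudorandom permutation ensembles exist, with some (polynomially bounded) key
length `κ` and a block length `ℓ n ≥ n` (module docstring: the floor rules out the vacuous
tiny-domain families and is what Luby–Rackoff's construction delivers, `ℓ n = 2n`).
**Status: an open existence hypothesis, not a theorem in print** — a sibling of `OWFExist`,
`PRGExist` and `PRFExist`, to be used as a hypothesis `(h : PRPExist)` and never discharged by a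
`PRPExist_holds` (CONVENTIONS §4: open conjectures are `def`s, not theorems). What is proved in
print is CONDITIONAL: Luby–Rackoff 1988 (abstract, LNCS 218, p. 447: "if `f^n` is pseudo-random
then `p^{2n}` is also pseudorandom … This result, together with the result of [GGM], implies that
if there is a pseudo-random number generator then there is a pseudorandom invertible permutation
generator"), i.e. `PRFExist → PRPExist` — the named fact `PRPExist_of_PRFExist` below (Goldreich
2001, §3.7.2, Construction 3.7.6 and Thm. 3.7.7). In the other direction `PRPExist` is at least as
strong as the existence of pseudorandom functions on super-polynomial domains: a PRP with block
length `ℓ n ≥ n` is a PRF (Goldreich 2001, §3.7.1, Prop. 3.7.3, the PRP/PRF switching lemma;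
proved in the tree as `IsPRP.isPRF_of_le`, file `PRPSwitchingLemma.lean`), pseudorandom functions
with super-logarithmic block length yield pseudorandom generators (Goldreich 2001, Cor. 3.6.8 and
§3.8.4 Exercise 28.1), hence one-way functions (Prop. 3.3.8), whose existence is itself only
conjectured and implies `P ≠ NP` (Goldreich 2001, §2.1; in the tree `P_ne_NP_of_OWFExist_holds`,
cf. `PseudorandomFunctionsPneNP.lean` for the parallel discussion of `PRFExist`).
[cite: LubyRackoff1988, abstract] [cite: AaronsonChen2017, Lemma 7.4] -/
def PRPExist : Prop :=
  ∃ (F : FunctionEnsemble) (κ ℓ : ℕ → ℕ), IsPRP F κ ℓ ∧ ∀ n, n ≤ ℓ n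

/-- **Luby–Rackoff**: pseudorandom functions yield pseudorandom permutations ("if `f^n` is
pseudo-random then `p^{2n}` is also pseudo-random": three Feistel rounds with independent
pseudorandom round functions permute `{0,1}^{2n}`), in the tree's existence form
`PRFExist → PRPExist`. Named fact. [cite: LubyRackoff1988, abstract (main result)] [cite: AaronsonChen2017, Lemma 7.4] -/
def PRPExist_of_PRFExist : Prop :=
  PRFExist → PRPExist

/-! ### API -/

/-- Every permutation has probability `1 / (2^a)!` under `randomPermPMF` (in particular the
support is everything). [cite: Goldreich2001, §3.7] -/
theorem randomPermPMF_apply (a : ℕ) (σ : Equiv.Perm (List.Vector Bool a)) :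
    randomPermPMF a σ = ((Fintype.card (Equiv.Perm (List.Vector Bool a)) : ENNReal))⁻¹ :=
  PMF.uniformOfFintype_apply σ

/-- `prpIdealProb` is nonnegative. [cite: Goldreich2001, Def. 3.7.2] -/
theorem prpIdealProb_nonneg (ℓ : ℕ → ℕ) (𝒜 : OracleAdversary Bool) (n : ℕ) :
    0 ≤ prpIdealProb ℓ 𝒜 n :=
  ENNReal.toReal_nonneg

/-- `prpIdealProb` is at most `1`. [cite: Goldreich2001, Def. 3.7.2] -/
theorem prpIdealProb_le_one (ℓ : ℕ → ℕ) (𝒜 : OracleAdversary Bool) (n : ℕ) :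
    prpIdealProb ℓ 𝒜 n ≤ 1 :=
  ENNReal.toReal_le_of_le_ofReal zero_le_one (by simpa using PMF.coe_le_one _ _)

/-- The PRP advantage is nonnegative. [cite: Goldreich2001, Def. 3.7.2] -/
theorem prpAdvantage_nonneg (F : FunctionEnsemble) (κ ℓ : ℕ → ℕ) (𝒜 : OracleAdversary Bool)
    (n : ℕ) : 0 ≤ prpAdvantage F κ ℓ 𝒜 n :=
  abs_nonneg _

/-- The PRP advantage is at most `1` (both probabilities lie in `[0,1]`). [cite: Goldreich2001, Def. 3.7.2] -/
theorem prpAdvantage_le_one (F : FunctionEnsemble) (κ ℓ : ℕ → ℕ) (𝒜 : OracleAdversary Bool)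
    (n : ℕ) : prpAdvantage F κ ℓ 𝒜 n ≤ 1 := by
  unfold prpAdvantage
  have h₁ := prfRealProb_nonneg F κ ℓ 𝒜 n
  have h₂ := prfRealProb_le_one F κ ℓ 𝒜 n
  have h₃ := prpIdealProb_nonneg ℓ 𝒜 n
  have h₄ := prpIdealProb_le_one ℓ 𝒜 n
  rw [abs_le]
  constructor <;> linarith

/-- The ideal-game probability is the expectation over the random permutation of the C4a
acceptance probability. [cite: Goldreich2001, Def. 3.7.2] -/
theorem prpIdealProb_eq_tsum (ℓ : ℕ → ℕ) (𝒜 : OracleAdversary Bool) (n : ℕ) :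
    prpIdealProb ℓ 𝒜 n =
      ∑' σ : Equiv.Perm (List.Vector Bool (ℓ n)),
        (randomPermPMF (ℓ n) σ).toReal * 𝒜.acceptProb (oracleOfTable σ) n := by
  rw [prpIdealProb, prpIdealPMF, PMF.bind_apply, ENNReal.tsum_toReal_eq]
  · simp_rw [ENNReal.toReal_mul]
    rfl
  · exact fun a => ENNReal.mul_ne_top (PMF.apply_ne_top _ _) (PMF.apply_ne_top _ _)

/-- A PRP is an efficiently computable family. [cite: Goldreich2001, Def. 3.7.2] -/
theorem IsPRP.isEfficientFamily {F : FunctionEnsemble} {κ ℓ : ℕ → ℕ} (h : IsPRP F κ ℓ) :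
    IsEfficientFamily F κ ℓ ℓ :=
  h.1

/-- A PRP is a permutation family. [cite: AaronsonChen2017, Def. 7.1] -/
theorem IsPRP.isPermutationFamily {F : FunctionEnsemble} {κ ℓ : ℕ → ℕ} (h : IsPRP F κ ℓ) :
    IsPermutationFamily F κ ℓ :=
  h.2.1

/-- Under a well-formed key a PRP is injective on its block: `F n k x = F n k y → x = y` for
`x, y ∈ {0,1}^{ℓ n}` (the property Zhandry's distinguisher exploits: a permutation has no
period). [cite: AaronsonChen2017, Def. 7.1 and §7.2] -/
theorem IsPRP.injOn {F : FunctionEnsemble} {κ ℓ : ℕ → ℕ} (h : IsPRP F κ ℓ) (n : ℕ)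
    {k : List Bool} (hk : k.length = κ n) :
    Set.InjOn (F n k) {x : List Bool | x.length = ℓ n} :=
  (h.2.1 n k hk).injOn

/-- The security clause of a PRP. [cite: Goldreich2001, Def. 3.7.2] [cite: AaronsonChen2017, Def. 7.2] -/
theorem IsPRP.superpolynomialDecay {F : FunctionEnsemble} {κ ℓ : ℕ → ℕ} (h : IsPRP F κ ℓ)
    {𝒜 : OracleAdversary Bool} (h𝒜 : 𝒜.IsPPT encodingBoolBool) :
    SuperpolynomialDecay atTop (fun n : ℕ => (n : ℝ)) (prpAdvantage F κ ℓ 𝒜) :=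
  h.2.2 𝒜 h𝒜

end Literature.Computability.Cryptography
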